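/-
Copyright (c) 2026 the pub-hodgecm-mathlib formalisation cell (harness21).  Prover seat hodgecm-mathlib-LH4-p17 (g3) (Track A «FOUR-FRAME» free hand routed to L1 by the
CHAIR VALVE; LEAD F0P6-plan (g15) BATCH #202 «(D-arch-split)»; block-D desk K2Liu-p12; K1-a♮ line lead K2E5-p16 (g8); consumer ★ p863709 (this base, g2)
`K2LiuIncoherentRankOneBlockDFacesOfWitness.hdead_of_packageWitness_rows_hbad`), Track B «K2-LIT», #184♮ = hLiu418 = `stmt-HodgeConjecture-24832`.
THEOREMS ONLY (no `def`, no instance, no notation, no named-fact hypothesis, no `sorry`, default heartbeats).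
-/
import Summits.HodgeConjecture.HodgeConjecture.Theorems.K2LiuFourierCoeffContinuedEuler   -- ★ `eqOn_halfPlane_of_eqOn_halfPlane` (identity theorem) + the frame vocabulary
import HarnessLib

/-!
# Crux `HLiu418`, #42S organ S5, BLOCK D row D-1 — THE PER-FACE ARCHIMEDEAN VALUE SPLIT `hsplit` OF ★ p863709 FROM THE PER-PLACE ARCH LETTERS
# (`Ac X i ½ h = cA X h i · ∏_{w∈Tinf} Acw X i w ½ h`: the continued archimedean block at the centre is the place tensor of the continued LOCAL values)

Cell `hodgecm-mathlib`, crux item hLiu418 = `stmt-HodgeConjecture-24832`, route `HCCMUnconditional`; squad K2 ∕ K2Liu (L1, LEAD F0P6-plan (g15)).  Lane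
`--supports stmt-HodgeConjecture-24832 --as helper` (count-neutral).  CLOSES NO SOCKET.

WHY (LEAD BATCH #202; desk K2Liu-p12 BLOCK D SLOT↦OWNER TABLE, row D-1; K2E3-typ4 v12∕v14 residual «D 16 [16]»).  ★ p863709
`K2LiuIncoherentRankOneBlockDFacesOfWitness.hdead_of_packageWitness_rows_hbad` docks BLOCK D on the K1-a♮ package ★ p863404
`K2LiuKindOneSingularTermPackage.exists_kindOne_singularTermPackage_of_placeLetters` and keeps, besides the package's own by-value data, exactly three archimedean
tokens: the DATA `Aw : Skew → H(𝔸) → φ → InfinitePlace L → ℂ`, `cA : Skew → H(𝔸) → φ → ℂ` and the ONE LETTER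
  `hsplit : ∀ X h, ↑X ≠ 0 → det ↑X = 0 → ∀ i ∈ I X h, Ac X i (1/2) h = cA X h i * ∏ w ∈ Tinf, Aw X h i w`
— the per-face archimedean VALUE SPLIT at the centre of the CONTINUED archimedean block `Ac X i s h` (★ p863404 §2 (ii)'s by-value letters `A Ac hAc hA`: the raw block
`A X i s h` = ONE integral over `N_Δ(L⁺ ⊗ ℝ)` — ★ p863805 (b) — agrees with `Ac X i s h` on `{1 < re s}`, `s ↦ Ac X i s h` holomorphic on `{0 < re s}`).  The archimedean
producers work PLACE BY PLACE (★ p863717 `K2LiuArchTwistedKTypeBlockContinuation.exists_archLetters_scalarType{_neg}` over ★ (3c-cont) p863260 ∕ ★ (3c-cont⁻) p863677, explicit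
★ p863574: per complex place `w` a raw twisted big-cell block `Aloc` and ONE continuation `Acw`, holomorphic on `{0 < re}`, `Aloc = Acw` on `{½ < re}` — kept at that printed threshold here), and on the convergence
half-plane the raw archimedean block of a pure-tensor face IS the place tensor `A X i s h = cA X h i · ∏_{w∈Tinf} Aloc X i w s h` (product Fubini over `N_Δ(L⁺⊗ℝ) = ∏_w N_Δ(L_w)`,
★ p862937 `K2LiuRankOneSingularHeadFactorisation.integral_prod_pi_mul_prod`'s shape; the scalar `cA` = Haar normalisation × the pure-tensor constants, `s`-free).  Two functions
holomorphic on the right half-plane that agree on `{1 < re}` agree on `{0 < re}` (identity theorem, ★ `K2LiuFourierCoeffContinuedEuler.eqOn_halfPlane_of_eqOn_halfPlane`),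
so the CONTINUED block is the place tensor of the CONTINUED local letters at EVERY `0 < re s` — in particular at `s = ½`, which is `hsplit` with
  `Aw X h i w := Acw X i w (1/2) h` (the continued LOCAL value at the centre — the object row D-3's `hpar hsgn hAzero` speak about) and `cA := cA`.
THIS FILE, hypothesis-first on those letters (all BY VALUE; the place type, face type, point type generic in §1):
* §1 **`continuation_eq_const_mul_prod`** — ONE face at ONE point: `Ac = c · ∏_{w∈Tinf} Acw w` on `{0 < re}` from `A = Ac`, `Aloc w = Acw w`, `A = c · ∏_w Aloc w` on `{c₀ < re}`
  (`0 ≤ c₀`) and holomorphy on `{0 < re}`;  **`ac_eq_mul_prod_of_placeLetters`** — the same indexed by `X` (rank one cut out by `p X → q X →`), the point `h` and the face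
  `i ∈ Iset X h`, at every `0 < re s`;  **`hsplit_of_placeLetters`** — its value at `s = ½` in ★ p863709's binder order.
* §2 **`ac_eq_cA_mul_prod_of_archLetters`** (every `0 < re s`) and the HEAD **`hsplit_faces_of_archLetters`** (`s = ½`) AT THE K2_Liu FRAME: ★ p863404 §2 (ii)'s binders
  `I A Ac hAc hA` VERBATIM (`S ↦ X`), the per-place letters `Aloc Acw hAcw hAw` in ★ p863717's shape lifted to the adelic point and the face, the place-tensor letter `hAinf`
  with its scalar `cA`; CONCLUSION = ★ p863709's `hsplit` binder type VERBATIM at `Aw := fun X h i w => Acw X i w (1/2) h`.  Tie (block D, row D-1):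
  `… (Aw := fun X h i w => Acw X i w (1/2) h) (cA := cA) (hsplit := hsplit_faces_of_archLetters L e dV hdV dW hdW I A Ac hAc hA Tinf Aloc Acw hAcw hAw cA hAinf) …`.
HONEST LABEL.  Count-neutral helper (identity theorem + `Finset.prod_congr`); the per-place letters and the place-tensor letter enter BY VALUE (payers: the (K1a-3-arch)
lineage ★ p863717 ∕ p863574 ∕ p863677 per place; the place-tensor identity by whoever states the per-place producers against ★ p863805 (b)'s archimedean integral);
`HC_CM` is proved only modulo the 7 printed citations (2 remaining named inputs: hLiu418 = `stmt-HodgeConjecture-24832`, h413 = `stmt-HodgeConjecture-24833`) until rung 0 closes.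

## References
* [KudlaRallis1994] S. Kudla, S. Rallis, *A regularized Siegel–Weil formula: the first term identity*, Ann. of Math. 140 (1994): §2 (2.10)–(2.12) (Euler factorisation of the
  Whittaker coefficients of factorizable sections, place by place).
* [Shimura1997] G. Shimura, *Euler Products and Eisenstein Series*, CBMS 93 (1997): §18.4–18.5 (archimedean Whittaker factors and their continuation).
* [Shimura1982] G. Shimura, *Confluent hypergeometric functions on tube domains*, Math. Ann. 260 (1982): §4 Thm. 4.2 (continuation of the local archimedean factor).
* [Conway1978] J. B. Conway, *Functions of One Complex Variable I*: IV §3 Thm. 3.7 (identity theorem).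
-/

set_option autoImplicit false
set_option linter.dupNamespace false -- the mandated namespace repeats `HodgeConjecture.HodgeConjecture`

noncomputable section

open scoped Matrix
open NumberField NumberField.InfinitePlace IsDedekindDomain
open Literature.NumberTheory.Automorphic Literature.NumberTheory.Automorphic.UnitaryGroup Literature.NumberTheory.GaloisRepresentations
open Literature.NumberTheory.GelbartRogawski1991 Literature.NumberTheory.GelbartRogawski1991.GRConstruction

namespace Summit.HodgeConjecture.HodgeConjecture.Cruxes.HLiu418.K2LiuIncoherentRankOneArchSplitOfFaces

open K2LiuSiegelUnipotentFourierDefs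
open K2LiuFourierCoeffContinuedEuler (eqOn_halfPlane_of_eqOn_halfPlane)

/-! ## §1 Generic: the continued archimedean block is the place tensor of the continued local letters on the whole right half-plane -/

/-- **ONE FACE AT ONE POINT.**  On `{c₀ < re}` (`0 ≤ c₀`) the raw archimedean block `A` agrees with its continuation `Ac`, each raw local letter `Aloc w` (`w ∈ Tinf`) with its
continuation `Acw w`, and the raw block is the place tensor `A s = c · ∏_{w∈Tinf} Aloc w s`; `Ac` and every `Acw w` are holomorphic on `{0 < re}`.  THEN
`Ac s = c · ∏_{w∈Tinf} Acw w s` for EVERY `0 < re s` (identity theorem on the right half-plane: both sides are holomorphic there and agree on `{c₀ < re}`).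
[cite: Conway1978, IV §3 Thm. 3.7] [cite: KudlaRallis1994, §2 (2.10)–(2.12)] [cite: Shimura1997, §18.4] -/
theorem continuation_eq_const_mul_prod {α : Type*} {c₀ : ℝ} (hc₀ : 0 ≤ c₀) (Tinf : Finset α)
    {A Ac : ℂ → ℂ} (hAc : DifferentiableOn ℂ Ac {s : ℂ | 0 < s.re}) (hA : ∀ s : ℂ, c₀ < s.re → A s = Ac s)
    {Aloc Acw : α → ℂ → ℂ} (hAcw : ∀ w ∈ Tinf, DifferentiableOn ℂ (Acw w) {s : ℂ | 0 < s.re})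
    (hAw : ∀ w ∈ Tinf, ∀ s : ℂ, c₀ < s.re → Aloc w s = Acw w s)
    (c : ℂ) (hprod : ∀ s : ℂ, c₀ < s.re → A s = c * ∏ w ∈ Tinf, Aloc w s) :
    ∀ s : ℂ, 0 < s.re → Ac s = c * ∏ w ∈ Tinf, Acw w s := by
  have h₂ : DifferentiableOn ℂ (fun s => c * ∏ w ∈ Tinf, Acw w s) {s : ℂ | 0 < s.re} :=
    (differentiableOn_const c).mul (DifferentiableOn.fun_finsetProd hAcw)
  have heq : ∀ s : ℂ, c₀ < s.re → Ac s = c * ∏ w ∈ Tinf, Acw w s := fun s hs => by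
    rw [← hA s hs, hprod s hs]
    exact congrArg _ (Finset.prod_congr rfl fun w hw => hAw w hw s hs)
  intro s hs
  exact eqOn_halfPlane_of_eqOn_halfPlane hc₀ hAc h₂ heq hs

/-- **INDEXED FORM (faces × points × indices), EVERY `0 < re s`.**  Index type `I` with the rank-one indices cut out by `p X → q X →`, point type `H`, faces `i ∈ Iset X h`, places
`w ∈ Tinf`; ★ p863404 §2 (ii)'s per-face arch letters `A Ac hAc hA` (generic, threshold `c₀ ≥ 0`), per-place letters `Aloc Acw hAcw hAw`, and the place-tensor letter
`A X i s h = cA X h i · ∏_{w∈Tinf} Aloc X i w s h` on `{c₀ < re}` ⟹ `Ac X i s h = cA X h i · ∏_{w∈Tinf} Acw X i w s h` on `{0 < re}`.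
[cite: Conway1978, IV §3 Thm. 3.7] [cite: KudlaRallis1994, §2 (2.10)–(2.12)] -/
theorem ac_eq_mul_prod_of_placeLetters {I H φ α : Type*} (p q : I → Prop) {c₀ : ℝ} (hc₀ : 0 ≤ c₀)
    {Iset : I → H → Finset φ} (Tinf : Finset α)
    {A Ac : I → φ → ℂ → H → ℂ}
    (hAc : ∀ X, p X → q X → ∀ (h : H), ∀ i ∈ Iset X h, DifferentiableOn ℂ (fun s => Ac X i s h) {s : ℂ | 0 < s.re})
    (hA : ∀ X, p X → q X → ∀ (h : H), ∀ i ∈ Iset X h, ∀ s : ℂ, c₀ < s.re → A X i s h = Ac X i s h)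
    {Aloc Acw : I → φ → α → ℂ → H → ℂ}
    (hAcw : ∀ X, p X → q X → ∀ (h : H), ∀ i ∈ Iset X h, ∀ w ∈ Tinf, DifferentiableOn ℂ (fun s => Acw X i w s h) {s : ℂ | 0 < s.re})
    (hAw : ∀ X, p X → q X → ∀ (h : H), ∀ i ∈ Iset X h, ∀ w ∈ Tinf, ∀ s : ℂ, c₀ < s.re → Aloc X i w s h = Acw X i w s h)
    (cA : I → H → φ → ℂ)
    (hAinf : ∀ X, p X → q X → ∀ (h : H), ∀ i ∈ Iset X h, ∀ s : ℂ, c₀ < s.re → A X i s h = cA X h i * ∏ w ∈ Tinf, Aloc X i w s h) :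
    ∀ X, p X → q X → ∀ (h : H), ∀ i ∈ Iset X h, ∀ s : ℂ, 0 < s.re → Ac X i s h = cA X h i * ∏ w ∈ Tinf, Acw X i w s h :=
  fun X hp hq h i hi =>
    continuation_eq_const_mul_prod hc₀ Tinf (A := fun s => A X i s h) (Ac := fun s => Ac X i s h) (hAc X hp hq h i hi) (hA X hp hq h i hi)
      (Aloc := fun w s => Aloc X i w s h) (Acw := fun w s => Acw X i w s h) (hAcw X hp hq h i hi) (hAw X hp hq h i hi) (cA X h i) (hAinf X hp hq h i hi)

/-- **THE VALUE SPLIT AT THE CENTRE (generic), in ★ p863709's binder order.**  Under the letters of `ac_eq_mul_prod_of_placeLetters`: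
`∀ X h, p X → q X → ∀ i ∈ Iset X h, Ac X i ½ h = cA X h i · ∏_{w∈Tinf} Acw X i w ½ h`. [cite: KudlaRallis1994, §2 (2.10)–(2.12)] [cite: Shimura1997, §18.4] -/
theorem hsplit_of_placeLetters {I H φ α : Type*} (p q : I → Prop) {c₀ : ℝ} (hc₀ : 0 ≤ c₀)
    {Iset : I → H → Finset φ} (Tinf : Finset α)
    {A Ac : I → φ → ℂ → H → ℂ}
    (hAc : ∀ X, p X → q X → ∀ (h : H), ∀ i ∈ Iset X h, DifferentiableOn ℂ (fun s => Ac X i s h) {s : ℂ | 0 < s.re})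
    (hA : ∀ X, p X → q X → ∀ (h : H), ∀ i ∈ Iset X h, ∀ s : ℂ, c₀ < s.re → A X i s h = Ac X i s h)
    {Aloc Acw : I → φ → α → ℂ → H → ℂ}
    (hAcw : ∀ X, p X → q X → ∀ (h : H), ∀ i ∈ Iset X h, ∀ w ∈ Tinf, DifferentiableOn ℂ (fun s => Acw X i w s h) {s : ℂ | 0 < s.re})
    (hAw : ∀ X, p X → q X → ∀ (h : H), ∀ i ∈ Iset X h, ∀ w ∈ Tinf, ∀ s : ℂ, c₀ < s.re → Aloc X i w s h = Acw X i w s h)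
    (cA : I → H → φ → ℂ)
    (hAinf : ∀ X, p X → q X → ∀ (h : H), ∀ i ∈ Iset X h, ∀ s : ℂ, c₀ < s.re → A X i s h = cA X h i * ∏ w ∈ Tinf, Aloc X i w s h) :
    ∀ (X : I) (h : H), p X → q X → ∀ i ∈ Iset X h, Ac X i (1 / 2) h = cA X h i * ∏ w ∈ Tinf, Acw X i w (1 / 2) h :=
  fun X h hp hq i hi =>
    ac_eq_mul_prod_of_placeLetters p q hc₀ Tinf hAc hA hAcw hAw cA hAinf X hp hq h i hi (1 / 2) (by norm_num)

/-! ## §2 At the K2_Liu frame: ★ p863709's `hsplit` letter from ★ p863404's `A Ac hAc hA` and the per-place arch letters -/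

section Frame

variable (L : Type) [Field L] [NumberField L] [IsCMField L]

variable {N M n : ℕ} (e : Fin N × Fin M ≃ Fin n)
  (dV : Fin N → L) (hdV : ∀ i, IsCMField.complexConj L (dV i) = dV i)
  (dW : Fin M → L) (hdW : ∀ i, IsCMField.complexConj L (dW i) = dW i)

/-- **THE CONTINUED ARCHIMEDEAN BLOCK IS THE PLACE TENSOR OF THE CONTINUED LOCAL LETTERS ON `{0 < re}` (K2_Liu frame).**  ★ p863404 §2 (ii)'s faces `I X h` and per-face
arch letters `A Ac hAc hA` VERBATIM (`S ↦ X`; `A = Ac` on `{1 < re}`, `s ↦ Ac X i s h` holomorphic on `{0 < re}`); per complex place `w ∈ Tinf` the raw local block `Aloc X i w s h`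
with its continuation `Acw X i w s h` (★ p863717's shape at the `w`-component: holomorphic on `{0 < re}`, `Aloc = Acw` on `{½ < re}` — ★'s printed threshold); and the place-tensor letter on `{1 < re}`
`A X i s h = cA X h i · ∏_{w∈Tinf} Aloc X i w s h` (product Fubini over `N_Δ(L⁺⊗ℝ)`, ★ p862937's shape; `cA` the Haar ∕ pure-tensor scalar).  THEN for every rank-one `X`, every `h`,
every face `i ∈ I X h` and every `0 < re s`: `Ac X i s h = cA X h i · ∏_{w∈Tinf} Acw X i w s h`.
[cite: KudlaRallis1994, §2 (2.10)–(2.12)] [cite: Shimura1997, §18.4] [cite: Shimura1982, §4 Thm. 4.2] [cite: Conway1978, IV §3 Thm. 3.7] -/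
theorem ac_eq_cA_mul_prod_of_archLetters {φ : Type*}
    (I : skewMatrices ((IsCMField.complexConj L : L ≃ₐ[Fp L] L) : L →+* L) ((gramR L e dV hdV dW hdW).map (algebraMap (Fp L) L)) → HA L e dV hdV dW hdW → Finset φ)
    -- ★ p863404 §2 (ii)'s per-face arch letters `A Ac hAc hA` VERBATIM (`S ↦ X`)
    (A : skewMatrices ((IsCMField.complexConj L : L ≃ₐ[Fp L] L) : L →+* L) ((gramR L e dV hdV dW hdW).map (algebraMap (Fp L) L)) → φ → ℂ → HA L e dV hdV dW hdW → ℂ)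
    (Ac : skewMatrices ((IsCMField.complexConj L : L ≃ₐ[Fp L] L) : L →+* L) ((gramR L e dV hdV dW hdW).map (algebraMap (Fp L) L)) → φ → ℂ → HA L e dV hdV dW hdW → ℂ)
    (hAc : ∀ X : skewMatrices ((IsCMField.complexConj L : L ≃ₐ[Fp L] L) : L →+* L) ((gramR L e dV hdV dW hdW).map (algebraMap (Fp L) L)),
      (X : Matrix (Fin n) (Fin n) L) ≠ 0 → (X : Matrix (Fin n) (Fin n) L).det = 0 → ∀ (h : HA L e dV hdV dW hdW), ∀ i ∈ I X h,
        DifferentiableOn ℂ (fun s => Ac X i s h) {s : ℂ | 0 < s.re})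
    (hA : ∀ X : skewMatrices ((IsCMField.complexConj L : L ≃ₐ[Fp L] L) : L →+* L) ((gramR L e dV hdV dW hdW).map (algebraMap (Fp L) L)),
      (X : Matrix (Fin n) (Fin n) L) ≠ 0 → (X : Matrix (Fin n) (Fin n) L).det = 0 → ∀ (h : HA L e dV hdV dW hdW), ∀ i ∈ I X h, ∀ s : ℂ, 1 < s.re → A X i s h = Ac X i s h)
    -- the per-place arch letters (★ p863717's `(A Ac hA hAc)` shape at the `w`-component, lifted to the adelic point and the face)
    (Tinf : Finset (InfinitePlace L))
    (Aloc : skewMatrices ((IsCMField.complexConj L : L ≃ₐ[Fp L] L) : L →+* L) ((gramR L e dV hdV dW hdW).map (algebraMap (Fp L) L)) → φ → InfinitePlace L → ℂ →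
      HA L e dV hdV dW hdW → ℂ)
    (Acw : skewMatrices ((IsCMField.complexConj L : L ≃ₐ[Fp L] L) : L →+* L) ((gramR L e dV hdV dW hdW).map (algebraMap (Fp L) L)) → φ → InfinitePlace L → ℂ →
      HA L e dV hdV dW hdW → ℂ)
    (hAcw : ∀ X : skewMatrices ((IsCMField.complexConj L : L ≃ₐ[Fp L] L) : L →+* L) ((gramR L e dV hdV dW hdW).map (algebraMap (Fp L) L)),
      (X : Matrix (Fin n) (Fin n) L) ≠ 0 → (X : Matrix (Fin n) (Fin n) L).det = 0 → ∀ (h : HA L e dV hdV dW hdW), ∀ i ∈ I X h, ∀ w ∈ Tinf,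
        DifferentiableOn ℂ (fun s => Acw X i w s h) {s : ℂ | 0 < s.re})
    (hAw : ∀ X : skewMatrices ((IsCMField.complexConj L : L ≃ₐ[Fp L] L) : L →+* L) ((gramR L e dV hdV dW hdW).map (algebraMap (Fp L) L)),
      (X : Matrix (Fin n) (Fin n) L) ≠ 0 → (X : Matrix (Fin n) (Fin n) L).det = 0 → ∀ (h : HA L e dV hdV dW hdW), ∀ i ∈ I X h, ∀ w ∈ Tinf,
        ∀ s : ℂ, 1 / 2 < s.re → Aloc X i w s h = Acw X i w s h)
    -- the place-tensor letter on the convergence half-plane, with its scalar `cA`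
    (cA : skewMatrices ((IsCMField.complexConj L : L ≃ₐ[Fp L] L) : L →+* L) ((gramR L e dV hdV dW hdW).map (algebraMap (Fp L) L)) → HA L e dV hdV dW hdW → φ → ℂ)
    (hAinf : ∀ X : skewMatrices ((IsCMField.complexConj L : L ≃ₐ[Fp L] L) : L →+* L) ((gramR L e dV hdV dW hdW).map (algebraMap (Fp L) L)),
      (X : Matrix (Fin n) (Fin n) L) ≠ 0 → (X : Matrix (Fin n) (Fin n) L).det = 0 → ∀ (h : HA L e dV hdV dW hdW), ∀ i ∈ I X h,
        ∀ s : ℂ, 1 < s.re → A X i s h = cA X h i * ∏ w ∈ Tinf, Aloc X i w s h) :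
    ∀ X : skewMatrices ((IsCMField.complexConj L : L ≃ₐ[Fp L] L) : L →+* L) ((gramR L e dV hdV dW hdW).map (algebraMap (Fp L) L)),
      (X : Matrix (Fin n) (Fin n) L) ≠ 0 → (X : Matrix (Fin n) (Fin n) L).det = 0 → ∀ (h : HA L e dV hdV dW hdW), ∀ i ∈ I X h,
        ∀ s : ℂ, 0 < s.re → Ac X i s h = cA X h i * ∏ w ∈ Tinf, Acw X i w s h :=
  ac_eq_mul_prod_of_placeLetters
    (fun X : skewMatrices ((IsCMField.complexConj L : L ≃ₐ[Fp L] L) : L →+* L) ((gramR L e dV hdV dW hdW).map (algebraMap (Fp L) L)) =>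
      (X : Matrix (Fin n) (Fin n) L) ≠ 0)
    (fun X : skewMatrices ((IsCMField.complexConj L : L ≃ₐ[Fp L] L) : L →+* L) ((gramR L e dV hdV dW hdW).map (algebraMap (Fp L) L)) =>
      (X : Matrix (Fin n) (Fin n) L).det = 0)
    zero_le_one Tinf hAc hA hAcw (fun X hX0 hdet h i hi w hw s hs => hAw X hX0 hdet h i hi w hw s (by linarith)) cA hAinf

/-- **`hsplit` OF ★ p863709 FROM THE ARCH LETTERS (the head; block D row D-1's archimedean value split).**  Under the letters of `ac_eq_cA_mul_prod_of_archLetters` (★ p863404 §2 (ii)'s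
`I A Ac hAc hA` VERBATIM; per-place `Aloc Acw hAcw hAw`; place tensor `cA hAinf`): ★ `K2LiuIncoherentRankOneBlockDFacesOfWitness.hdead_of_packageWitness_rows_hbad`'s `hsplit`
binder VERBATIM at `Aw := fun X h i w => Acw X i w (1/2) h` (the continued LOCAL value at the centre) and `cA := cA`:
`∀ X h, ↑X ≠ 0 → det ↑X = 0 → ∀ i ∈ I X h, Ac X i (1/2) h = cA X h i * ∏ w ∈ Tinf, Acw X i w (1/2) h`.
[cite: KudlaRallis1994, §2 (2.10)–(2.12)] [cite: Shimura1997, §18.4] [cite: Shimura1982, §4 Thm. 4.2] [cite: Conway1978, IV §3 Thm. 3.7] -/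
theorem hsplit_faces_of_archLetters {φ : Type*}
    (I : skewMatrices ((IsCMField.complexConj L : L ≃ₐ[Fp L] L) : L →+* L) ((gramR L e dV hdV dW hdW).map (algebraMap (Fp L) L)) → HA L e dV hdV dW hdW → Finset φ)
    -- ★ p863404 §2 (ii)'s per-face arch letters `A Ac hAc hA` VERBATIM (`S ↦ X`)
    (A : skewMatrices ((IsCMField.complexConj L : L ≃ₐ[Fp L] L) : L →+* L) ((gramR L e dV hdV dW hdW).map (algebraMap (Fp L) L)) → φ → ℂ → HA L e dV hdV dW hdW → ℂ)
    (Ac : skewMatrices ((IsCMField.complexConj L : L ≃ₐ[Fp L] L) : L →+* L) ((gramR L e dV hdV dW hdW).map (algebraMap (Fp L) L)) → φ → ℂ → HA L e dV hdV dW hdW → ℂ)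
    (hAc : ∀ X : skewMatrices ((IsCMField.complexConj L : L ≃ₐ[Fp L] L) : L →+* L) ((gramR L e dV hdV dW hdW).map (algebraMap (Fp L) L)),
      (X : Matrix (Fin n) (Fin n) L) ≠ 0 → (X : Matrix (Fin n) (Fin n) L).det = 0 → ∀ (h : HA L e dV hdV dW hdW), ∀ i ∈ I X h,
        DifferentiableOn ℂ (fun s => Ac X i s h) {s : ℂ | 0 < s.re})
    (hA : ∀ X : skewMatrices ((IsCMField.complexConj L : L ≃ₐ[Fp L] L) : L →+* L) ((gramR L e dV hdV dW hdW).map (algebraMap (Fp L) L)),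
      (X : Matrix (Fin n) (Fin n) L) ≠ 0 → (X : Matrix (Fin n) (Fin n) L).det = 0 → ∀ (h : HA L e dV hdV dW hdW), ∀ i ∈ I X h, ∀ s : ℂ, 1 < s.re → A X i s h = Ac X i s h)
    -- the per-place arch letters (★ p863717's `(A Ac hA hAc)` shape at the `w`-component, lifted to the adelic point and the face)
    (Tinf : Finset (InfinitePlace L))
    (Aloc : skewMatrices ((IsCMField.complexConj L : L ≃ₐ[Fp L] L) : L →+* L) ((gramR L e dV hdV dW hdW).map (algebraMap (Fp L) L)) → φ → InfinitePlace L → ℂ →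
      HA L e dV hdV dW hdW → ℂ)
    (Acw : skewMatrices ((IsCMField.complexConj L : L ≃ₐ[Fp L] L) : L →+* L) ((gramR L e dV hdV dW hdW).map (algebraMap (Fp L) L)) → φ → InfinitePlace L → ℂ →
      HA L e dV hdV dW hdW → ℂ)
    (hAcw : ∀ X : skewMatrices ((IsCMField.complexConj L : L ≃ₐ[Fp L] L) : L →+* L) ((gramR L e dV hdV dW hdW).map (algebraMap (Fp L) L)),
      (X : Matrix (Fin n) (Fin n) L) ≠ 0 → (X : Matrix (Fin n) (Fin n) L).det = 0 → ∀ (h : HA L e dV hdV dW hdW), ∀ i ∈ I X h, ∀ w ∈ Tinf,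
        DifferentiableOn ℂ (fun s => Acw X i w s h) {s : ℂ | 0 < s.re})
    (hAw : ∀ X : skewMatrices ((IsCMField.complexConj L : L ≃ₐ[Fp L] L) : L →+* L) ((gramR L e dV hdV dW hdW).map (algebraMap (Fp L) L)),
      (X : Matrix (Fin n) (Fin n) L) ≠ 0 → (X : Matrix (Fin n) (Fin n) L).det = 0 → ∀ (h : HA L e dV hdV dW hdW), ∀ i ∈ I X h, ∀ w ∈ Tinf,
        ∀ s : ℂ, 1 / 2 < s.re → Aloc X i w s h = Acw X i w s h)
    -- the place-tensor letter on the convergence half-plane, with its scalar `cA`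
    (cA : skewMatrices ((IsCMField.complexConj L : L ≃ₐ[Fp L] L) : L →+* L) ((gramR L e dV hdV dW hdW).map (algebraMap (Fp L) L)) → HA L e dV hdV dW hdW → φ → ℂ)
    (hAinf : ∀ X : skewMatrices ((IsCMField.complexConj L : L ≃ₐ[Fp L] L) : L →+* L) ((gramR L e dV hdV dW hdW).map (algebraMap (Fp L) L)),
      (X : Matrix (Fin n) (Fin n) L) ≠ 0 → (X : Matrix (Fin n) (Fin n) L).det = 0 → ∀ (h : HA L e dV hdV dW hdW), ∀ i ∈ I X h,
        ∀ s : ℂ, 1 < s.re → A X i s h = cA X h i * ∏ w ∈ Tinf, Aloc X i w s h) :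
    ∀ (X : skewMatrices ((IsCMField.complexConj L : L ≃ₐ[Fp L] L) : L →+* L) ((gramR L e dV hdV dW hdW).map (algebraMap (Fp L) L))) (h : HA L e dV hdV dW hdW),
      (X : Matrix (Fin n) (Fin n) L) ≠ 0 → (X : Matrix (Fin n) (Fin n) L).det = 0 → ∀ i ∈ I X h,
        Ac X i (1 / 2) h = cA X h i * ∏ w ∈ Tinf, Acw X i w (1 / 2) h :=
  fun X h hX0 hdet i hi =>
    ac_eq_cA_mul_prod_of_archLetters L e dV hdV dW hdW I A Ac hAc hA Tinf Aloc Acw hAcw hAw cA hAinf X hX0 hdet h i hi (1 / 2) (by norm_num)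

end Frame

end Summit.HodgeConjecture.HodgeConjecture.Cruxes.HLiu418.K2LiuIncoherentRankOneArchSplitOfFaces

end
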